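import Mathlib
import HarnessLib
import Summits.NavierStokesRegularity.NavierStokesRegularity.Theorems.TaoLadderRungTwoBreakEternalRigidityViscBddOneUniformAction

/-!
# Crux `TaoLadderRungTwoBreak.EternalRigidityViscBddOne` (stmt-NavierStokesRegularity-20420), stub (ω4): ERRATUM and REPAIR of
# `…UniformAction` — the summable wake must be asked only over a HALF-LIFE after each anchor

MODEL lattice ODEs only (Tao 2016 §4, `m = 4`, registered vocabulary `ViscousUpTo`/`BlowsUpAt`/`TypeOne` of skeleton `85fbfe8e90eea58b`);
nothing here is a statement about the Navier–Stokes equations; no stub, crux or summit is closed (`--supports` ⟨20420⟩).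

ERRATUM (`not_summable_wakeProfile`).  The hypothesis pair «(WC) with profile `P` for ALL later times `t ∈ [t_a, t⋆)`» ∧ «`P` summable
over `ℤ`» of the tree's `uniformCriticalAction_of_summableWake` / `eternalLimitViscBdd_of_summableWake` is UNSATISFIABLE for a blow-up
trajectory: the critical front keeps advancing (`typeOne_quantity_lower_bound` at every time), and read in the FIXED normalisation of an
early anchor it forces `P(F(t) − F(t_a)) ≥ c (t⋆−t_a)/(t⋆−t) → ∞`, so `P` is unbounded.  Those two theorems are therefore VACUOUS as stated
(their §1 lemmas `intervalIntegral_le_sum_of_anchored`, `card_le_of_pairwise_le`, `sum_le_of_sparse_fibers`,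
`integrableOn_Ico_of_intervalIntegral_le` are unaffected and reused here).

REPAIR.  The block bookkeeping only ever uses the wake bound up to the NEXT dyadic anchor.  The consistent hypothesis is the HALF-LIFE
co-moving envelope (HL): after every late anchor `t_a` with front shell `F`, for `t ∈ [t_a, t_a + (t⋆−t_a)/2]` and every `n`,
`Λ^{n+F}(t⋆−t_a)‖X_{n+F}(t)‖ ≤ p n` with `p` summable over `ℤ` (precursor decay ahead of the front, calming behind it, both in the
anchor's own scale — satisfied e.g. by discretely self-similar trajectories with a summable period profile).  Then
(UA) ⟸ type I + (FE) + (HL) (`uniformCriticalAction_of_halfLifeWake`) and, feeding the tree's `eternalLimitViscBdd_of_frontData`,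
(ω4) ⟸ (ω3) ∧ (FE) ∧ (WC) ∧ (HL) (`eternalLimitViscBdd_of_halfLifeWake`): the integral hypothesis (UA) is traded for the pointwise
half-life envelope (HL).  HONEST LABEL: bookkeeping; (FE), (WC), (HL), (ω3), (ω4), ⟨20420⟩ and every NS statement remain OPEN; rung 0.
-/

noncomputable section

-- the summit and its single sub-problem share the name (CONVENTIONS §1)
set_option linter.dupNamespace false

open Set Filter Topology MeasureTheory
open Literature.Analysis.FluidPDE Literature.Analysis.FluidPDE.TaoCascade
open Summit.NavierStokesRegularity.NavierStokesRegularity.Theorems.BlowupRigidityOne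
open Summit.NavierStokesRegularity.NavierStokesRegularity.Theorems.MinimalViscousBlowup.ThresholdRay
open Summit.NavierStokesRegularity.NavierStokesRegularity.Theorems.EternalRigidityViscBddOne.Birth
open Summit.NavierStokesRegularity.NavierStokesRegularity.Theorems.EternalRigidityViscBddOne.CriticalRate
open Summit.NavierStokesRegularity.NavierStokesRegularity.Theorems.EternalRigidityViscBddOne.CriticalFront
open Summit.NavierStokesRegularity.NavierStokesRegularity.Theorems.EternalRigidityViscBddOne.FrontClock
open Summit.NavierStokesRegularity.NavierStokesRegularity.Theorems.EternalRigidityViscBddOne.ViscousLawLimit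

namespace Summit.NavierStokesRegularity.NavierStokesRegularity.Theorems.EternalRigidityViscBddOne.UniformAction

/-- **ERRATUM: the all-time summable wake profile is inconsistent with blow-up.**  For a regular `ν`-viscous trajectory blowing up at
`t⋆`, a wake-calming bound «after a late anchor `t_a` with front `F`, `Λ^{n+F}(t⋆−t_a)‖X_{n+F}(t)‖ ≤ P n` for ALL `t ∈ [t_a,t⋆)` and all `n`»
forces `P` to be unbounded (the advancing critical front, read in the anchor's fixed scale); in particular `P ≥ 0` is NOT summable, and
`uniformCriticalAction_of_summableWake`, `eternalLimitViscBdd_of_summableWake` have unsatisfiable hypotheses.  MODEL lattice only.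
[cite: Tao2016AveragedNS, §4 Thm. 4.2 (statement shape), §6.4; cell vocabulary (stmt-NavierStokesRegularity-20420)] -/
theorem not_summable_wakeProfile {R ε₀ ν : ℝ} (hε₀ : 0 < ε₀) (hν : 0 < ν)
    {α : Fin 4 → Fin 4 → Fin 4 → ℤ × ℤ × ℤ → ℝ} (hα : InTableClass R α) {X₀ : Fin 4 → ℝ}
    {X : Fin 4 → ℤ → ℝ → ℝ} {tStar : ℝ} (hV : ViscousUpTo ε₀ ν α X₀ X tStar) (hB : BlowsUpAt ε₀ X tStar)
    {P : ℤ → ℝ} (hP0 : ∀ n, 0 ≤ P n)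
    (hWC : ∃ t₃ : ℝ, t₃ < tStar ∧ ∀ ta : ℝ, 0 ≤ ta → t₃ ≤ ta → ta < tStar → ∀ (i : Fin 4) (F : ℤ),
      1 / (32 * (3 + bigLam ε₀)) ≤ bigLam ε₀ ^ F * |X i F ta| * (tStar - ta) →
        ∀ (n : ℤ) (t : ℝ), ta ≤ t → t < tStar →
          bigLam ε₀ ^ (n + F) * (tStar - ta) * ‖shellVec X (n + F) t‖ ≤ P n) :
    ¬ Summable P := by
  intro hPs
  have hΛ : 0 < bigLam ε₀ := bigLam_pos (by linarith)
  have hT : 0 < tStar := hV.pos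
  set cs : ℝ := 1 / (32 * (3 + bigLam ε₀)) with hcs
  have hcs0 : 0 < cs := by rw [hcs]; positivity
  obtain ⟨t₃, ht₃T, hwc⟩ := hWC
  set ta : ℝ := max t₃ 0 with hta
  have hta0 : 0 ≤ ta := le_max_right _ _
  have hta3 : t₃ ≤ ta := le_max_left _ _
  have htaT : ta < tStar := max_lt ht₃T hT
  have hgap : 0 < tStar - ta := by linarith
  obtain ⟨i₀, F₀, hF₀⟩ := typeOne_quantity_lower_bound hε₀ hν hα hV hB ta hta0 htaT
  set S : ℝ := ∑' m, P m with hS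
  have hS0 : 0 ≤ S := tsum_nonneg hP0
  have hPle : ∀ n, P n ≤ S := fun n => hPs.le_tsum n fun m _ => hP0 m
  -- a time `t` so late that `cs (t⋆ − t_a) > S (t⋆ − t)`
  set δ : ℝ := cs * (tStar - ta) / (S + cs) with hδ
  have hSc : 0 < S + cs := by linarith
  have hδ0 : 0 < δ := by rw [hδ]; positivity
  have hδle : δ ≤ tStar - ta := by
    rw [hδ, div_le_iff₀ hSc]
    nlinarith
  set t : ℝ := tStar - δ with htdef
  have htat : ta ≤ t := by rw [htdef]; linarith
  have ht0 : 0 ≤ t := hta0.trans htat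
  have htT : t < tStar := by rw [htdef]; linarith
  obtain ⟨i, F, hF⟩ := typeOne_quantity_lower_bound hε₀ hν hα hV hB t ht0 htT
  have h := hwc ta hta0 hta3 htaT i₀ F₀ hF₀ (F - F₀) t htat htT
  rw [sub_add_cancel] at h
  have h1 : cs ≤ bigLam ε₀ ^ F * ‖shellVec X F t‖ * (tStar - t) := by
    refine hF.trans ?_
    have := abs_apply_le_norm_shellVec X F t i
    have hL : 0 ≤ bigLam ε₀ ^ F := (zpow_pos hΛ F).le
    have htt : 0 ≤ tStar - t := by linarith
    exact mul_le_mul_of_nonneg_right (mul_le_mul_of_nonneg_left this hL) htt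
  have h2 : bigLam ε₀ ^ F * (tStar - ta) * ‖shellVec X F t‖ ≤ S := h.trans (hPle _)
  -- `cs (t⋆ − t_a) ≤ S (t⋆ − t) = S δ < cs (t⋆ − t_a)`
  have h3 : cs * (tStar - ta) ≤ S * (tStar - t) := by
    have := mul_le_mul_of_nonneg_right h1 hgap.le
    calc cs * (tStar - ta) ≤ bigLam ε₀ ^ F * ‖shellVec X F t‖ * (tStar - t) * (tStar - ta) := this
      _ = bigLam ε₀ ^ F * (tStar - ta) * ‖shellVec X F t‖ * (tStar - t) := by ring
      _ ≤ S * (tStar - t) := mul_le_mul_of_nonneg_right h2 (by linarith)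
  have h4 : tStar - t = δ := by rw [htdef]; ring
  rw [h4, hδ] at h3
  have h5 : S * (cs * (tStar - ta) / (S + cs)) < cs * (tStar - ta) := by
    rw [mul_div_assoc', div_lt_iff₀ hSc]
    nlinarith [mul_pos hcs0 hgap]
  linarith

/-- **Dyadic block bound, half-life form.**  If `f` is continuous on `[t₀, t⋆)` and after every anchor `s ∈ [t₀,t⋆)` it obeys
`f(t)(t⋆ − s) ≤ G(s)` for `t ∈ [s, s + (t⋆−s)/2]` (one half-life only), then along the dyadic anchors `s_j = t⋆ − (t⋆−t₀)/2^j`: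
`∫_{t₀}^{s_J} f ≤ ½ Σ_{j<J} G(s_j)`. [folklore] -/
theorem intervalIntegral_le_sum_of_halfLife {f G : ℝ → ℝ} {t₀ tStar : ℝ} (ht : t₀ < tStar)
    (hf : ContinuousOn f (Ico t₀ tStar))
    (hG : ∀ s : ℝ, t₀ ≤ s → s < tStar → ∀ t : ℝ, s ≤ t → t ≤ s + (tStar - s) / 2 → f t * (tStar - s) ≤ G s)
    (J : ℕ) :
    ∫ t in t₀..(tStar - (tStar - t₀) / 2 ^ J), f t ≤
      (1 / 2) * ∑ j ∈ Finset.range J, G (tStar - (tStar - t₀) / 2 ^ j) := by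
  have hT0 : 0 < tStar - t₀ := by linarith
  have hs_lt : ∀ j : ℕ, tStar - (tStar - t₀) / 2 ^ j < tStar := fun j => by
    have : 0 < (tStar - t₀) / 2 ^ j := by positivity
    linarith
  have hs_ge : ∀ j : ℕ, t₀ ≤ tStar - (tStar - t₀) / 2 ^ j := fun j => by
    have h1 : (tStar - t₀) / 2 ^ j ≤ tStar - t₀ := div_le_self hT0.le (one_le_pow₀ (by norm_num))
    linarith
  have hhalf : ∀ j : ℕ, tStar - (tStar - t₀) / 2 ^ (j + 1)
      = (tStar - (tStar - t₀) / 2 ^ j) + (tStar - (tStar - (tStar - t₀) / 2 ^ j)) / 2 := fun j => by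
    rw [pow_succ]
    field_simp
    ring
  have hmono : ∀ j : ℕ, tStar - (tStar - t₀) / 2 ^ j ≤ tStar - (tStar - t₀) / 2 ^ (j + 1) := fun j => by
    rw [hhalf j]
    have : 0 ≤ (tStar - (tStar - (tStar - t₀) / 2 ^ j)) / 2 := by
      have := hs_lt j
      positivity
    linarith
  have hii : ∀ a b : ℝ, t₀ ≤ a → a ≤ b → b < tStar → IntervalIntegrable f volume a b := fun a b ha hab hb =>
    (hf.mono fun x hx => ⟨ha.trans hx.1, lt_of_le_of_lt hx.2 hb⟩).intervalIntegrable_of_Icc hab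
  induction J with
  | zero => simp
  | succ J ih =>
    have hint1 : IntervalIntegrable f volume t₀ (tStar - (tStar - t₀) / 2 ^ J) :=
      hii _ _ le_rfl (hs_ge J) (hs_lt J)
    have hint2 : IntervalIntegrable f volume (tStar - (tStar - t₀) / 2 ^ J)
        (tStar - (tStar - t₀) / 2 ^ (J + 1)) := hii _ _ (hs_ge J) (hmono J) (hs_lt (J + 1))
    rw [← intervalIntegral.integral_add_adjacent_intervals hint1 hint2, Finset.sum_range_succ, mul_add]
    refine add_le_add ih ?_
    have hpos : 0 < (tStar - t₀) / 2 ^ J := by positivity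
    have hbound : ∀ t ∈ Icc (tStar - (tStar - t₀) / 2 ^ J) (tStar - (tStar - t₀) / 2 ^ (J + 1)),
        f t ≤ G (tStar - (tStar - t₀) / 2 ^ J) / ((tStar - t₀) / 2 ^ J) := by
      intro t ht
      have ht2 : t ≤ (tStar - (tStar - t₀) / 2 ^ J) + (tStar - (tStar - (tStar - t₀) / 2 ^ J)) / 2 := by
        rw [← hhalf J]
        exact ht.2
      have h := hG _ (hs_ge J) (hs_lt J) t ht.1 ht2
      rw [le_div_iff₀ hpos]
      have h2 : tStar - (tStar - (tStar - t₀) / 2 ^ J) = (tStar - t₀) / 2 ^ J := by ring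
      rwa [h2] at h
    have hlen : tStar - (tStar - t₀) / 2 ^ (J + 1) - (tStar - (tStar - t₀) / 2 ^ J)
        = ((tStar - t₀) / 2 ^ J) / 2 := by
      rw [pow_succ]
      ring
    calc ∫ t in (tStar - (tStar - t₀) / 2 ^ J)..(tStar - (tStar - t₀) / 2 ^ (J + 1)), f t
        ≤ ∫ _t in (tStar - (tStar - t₀) / 2 ^ J)..(tStar - (tStar - t₀) / 2 ^ (J + 1)),
            G (tStar - (tStar - t₀) / 2 ^ J) / ((tStar - t₀) / 2 ^ J) :=
          intervalIntegral.integral_mono_on (hmono J) hint2 intervalIntegrable_const hbound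
      _ = (1 / 2) * G (tStar - (tStar - t₀) / 2 ^ J) := by
          rw [intervalIntegral.integral_const, smul_eq_mul, hlen]
          field_simp

/-- **(UA) ⟸ TYPE I + (FE) + HALF-LIFE WAKE (HL).**  For a regular `ν`-viscous trajectory blowing up at `t⋆` at the type-I rate, with the
front a=1 envelope (FE) and the half-life co-moving envelope (HL) — after every late anchor `t_a` with front shell `F`, for
`t ∈ [t_a, t_a + (t⋆−t_a)/2]` and all `n`: `Λ^{n+F}(t⋆−t_a)‖X_{n+F}(t)‖ ≤ p n`, `p ≥ 0` summable over `ℤ` — the critical action is uniformly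
bounded: `Λ^k ∫_{[0,t⋆)} ‖X_k‖ ≤ A` for every shell `k`.  MODEL lattice only.
[cite: Tao2016AveragedNS, §4 Thm. 4.2 (statement shape), the viscous equation before it, §6.4; cell vocabulary (stmt-NavierStokesRegularity-20420, stub (ω4))] -/
theorem uniformCriticalAction_of_halfLifeWake {R ε₀ ν : ℝ} (hε₀ : 0 < ε₀) (hν : 0 < ν)
    {α : Fin 4 → Fin 4 → Fin 4 → ℤ × ℤ × ℤ → ℝ} (hα : InTableClass R α) {X₀ : Fin 4 → ℝ}
    {X : Fin 4 → ℤ → ℝ → ℝ} {tStar : ℝ} (hV : ViscousUpTo ε₀ ν α X₀ X tStar) (hB : BlowsUpAt ε₀ X tStar)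
    (hT1 : TypeOne ε₀ X tStar)
    (hEnv : ∃ Q t₂ : ℝ, t₂ < tStar ∧ ∀ t : ℝ, 0 ≤ t → t₂ ≤ t → t < tStar → ∀ (i : Fin 4) (F : ℤ),
      1 / (32 * (3 + bigLam ε₀)) ≤ bigLam ε₀ ^ F * |X i F t| * (tStar - t) →
        (1 + ε₀) ^ ((F : ℝ) / 2) * |X i F t| ≤ Q)
    {p : ℤ → ℝ} (hp0 : ∀ n, 0 ≤ p n) (hps : Summable p)
    (hHL : ∃ t₃ : ℝ, t₃ < tStar ∧ ∀ ta : ℝ, 0 ≤ ta → t₃ ≤ ta → ta < tStar → ∀ (i : Fin 4) (F : ℤ),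
      1 / (32 * (3 + bigLam ε₀)) ≤ bigLam ε₀ ^ F * |X i F ta| * (tStar - ta) →
        ∀ (n : ℤ) (t : ℝ), ta ≤ t → t ≤ ta + (tStar - ta) / 2 →
          bigLam ε₀ ^ (n + F) * (tStar - ta) * ‖shellVec X (n + F) t‖ ≤ p n) :
    ∃ A : ℝ, ∀ k : ℤ, IntegrableOn (fun t => ‖shellVec X k t‖) (Ico 0 tStar) ∧
      bigLam ε₀ ^ k * (∫ t in Ico 0 tStar, ‖shellVec X k t‖) ≤ A := by
  have hl0 : (0 : ℝ) < 1 + ε₀ := by linarith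
  have hε : (-1 : ℝ) < ε₀ := by linarith
  have hΛ : 0 < bigLam ε₀ := bigLam_pos hε
  have hT : 0 < tStar := hV.pos
  set cs : ℝ := 1 / (32 * (3 + bigLam ε₀)) with hcs
  have hcs0 : 0 < cs := by rw [hcs]; positivity
  obtain ⟨K₁, t₁, hK₁, ht₁T, hclock⟩ := frontClock_of_typeOne hε₀ hν hα hV hT1
  obtain ⟨Q, t₂, ht₂T, henv⟩ := hEnv
  obtain ⟨C₀, hC₀⟩ := hT1
  set C : ℝ := 2 * max C₀ 0 with hCdef
  have hC0 : 0 ≤ C := by rw [hCdef]; positivity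
  have htypeI : ∀ (n : ℤ) (t : ℝ), 0 ≤ t → t < tStar →
      bigLam ε₀ ^ n * (tStar - t) * ‖shellVec X n t‖ ≤ C := by
    intro n t ht0 htT
    have hLt : 0 < bigLam ε₀ ^ n * (tStar - t) := mul_pos (zpow_pos hΛ n) (by linarith)
    have hcomp : ∀ j : Fin 4, |X j n t| ≤ max C₀ 0 / (bigLam ε₀ ^ n * (tStar - t)) := by
      intro j
      rw [le_div_iff₀ hLt]
      calc |X j n t| * (bigLam ε₀ ^ n * (tStar - t)) = bigLam ε₀ ^ n * |X j n t| * (tStar - t) := by ring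
        _ ≤ C₀ := hC₀ t ht0 htT j n
        _ ≤ max C₀ 0 := le_max_left _ _
    have h := norm_shellVec_le_two_mul (div_nonneg (le_max_right _ _) hLt.le) hcomp
    have hne : bigLam ε₀ ^ n * (tStar - t) ≠ 0 := hLt.ne'
    calc bigLam ε₀ ^ n * (tStar - t) * ‖shellVec X n t‖
        ≤ bigLam ε₀ ^ n * (tStar - t) * (2 * (max C₀ 0 / (bigLam ε₀ ^ n * (tStar - t)))) :=
          mul_le_mul_of_nonneg_left h hLt.le
      _ = C := by rw [hCdef, mul_comm (2 : ℝ) _, ← mul_assoc, mul_div_cancel₀ _ hne, mul_comm]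
  obtain ⟨t₃, ht₃T, hhl⟩ := hHL
  set t₀ : ℝ := max (max t₁ t₂) (max t₃ 0) with ht₀
  have ht₀T : t₀ < tStar := max_lt (max_lt ht₁T ht₂T) (max_lt ht₃T hT)
  have hgap : 0 < tStar - t₀ := by linarith
  have h0t₀ : 0 ≤ t₀ := (le_max_right _ _).trans (le_max_right _ _)
  have h1t₀ : t₁ ≤ t₀ := (le_max_left _ _).trans (le_max_left _ _)
  have h2t₀ : t₂ ≤ t₀ := (le_max_right _ _).trans (le_max_left _ _)
  have h3t₀ : t₃ ≤ t₀ := (le_max_left _ _).trans (le_max_right _ _)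
  have hfront : ∀ t : ℝ, 0 ≤ t → t < tStar →
      ∃ (i : Fin 4) (F : ℤ), cs ≤ bigLam ε₀ ^ F * |X i F t| * (tStar - t) :=
    fun t ht0 htT => typeOne_quantity_lower_bound hε₀ hν hα hV hB t ht0 htT
  choose! iF FF hFF using hfront
  have hQpos : 0 < Q := by
    have h := henv t₀ h0t₀ h2t₀ ht₀T (iF t₀) (FF t₀) (hFF t₀ h0t₀ ht₀T)
    have hX : X (iF t₀) (FF t₀) t₀ ≠ 0 := by
      intro h0
      have := hFF t₀ h0t₀ ht₀T
      rw [h0, abs_zero, mul_zero, zero_mul] at this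
      exact absurd this (not_le.2 hcs0)
    exact lt_of_lt_of_le (mul_pos (Real.rpow_pos_of_pos hl0 _) (abs_pos.2 hX)) h
  set m₁ : ℝ := cs * ν / Q with hm₁
  have hm₁0 : 0 < m₁ := by rw [hm₁]; positivity
  have hlow : ∀ t : ℝ, t₀ ≤ t → t < tStar → m₁ ≤ ν * (1 + ε₀) ^ ((2 : ℝ) * FF t) * (tStar - t) := by
    intro t ht htT
    have ht0 : 0 ≤ t := h0t₀.trans ht
    exact lowerClock_of_frontEnvelope hε hν.le hcs0 (hFF t ht0 htT)
      (henv t ht0 (h2t₀.trans ht) htT _ _ (hFF t ht0 htT))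
  have hup : ∀ t : ℝ, t₀ ≤ t → t < tStar → ν * (1 + ε₀) ^ ((2 : ℝ) * FF t) * (tStar - t) < K₁ := by
    intro t ht htT
    have ht0 : 0 ≤ t := h0t₀.trans ht
    exact hclock t ht0 (h1t₀.trans ht) htT _ _ (hFF t ht0 htT)
  set s : ℕ → ℝ := fun j => tStar - (tStar - t₀) / 2 ^ j with hsdef
  have hs_lt : ∀ j : ℕ, s j < tStar := fun j => by
    have : 0 < (tStar - t₀) / 2 ^ j := by positivity
    simp only [hsdef]
    linarith
  have hs_ge : ∀ j : ℕ, t₀ ≤ s j := fun j => by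
    have h1 : (tStar - t₀) / 2 ^ j ≤ tStar - t₀ := div_le_self hgap.le (one_le_pow₀ (by norm_num))
    simp only [hsdef]
    linarith
  have hs0 : ∀ j : ℕ, 0 ≤ s j := fun j => h0t₀.trans (hs_ge j)
  have hs_tend : Tendsto s atTop (𝓝 tStar) := by
    have h1 : Tendsto (fun j : ℕ => (tStar - t₀) * (1 / 2 : ℝ) ^ j) atTop (𝓝 ((tStar - t₀) * 0)) :=
      (tendsto_pow_atTop_nhds_zero_of_lt_one (by norm_num) (by norm_num)).const_mul _
    rw [mul_zero] at h1
    have h2 : Tendsto (fun j : ℕ => tStar - (tStar - t₀) * (1 / 2 : ℝ) ^ j) atTop (𝓝 (tStar - 0)) :=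
      h1.const_sub tStar
    rw [sub_zero] at h2
    refine h2.congr fun j => ?_
    show tStar - (tStar - t₀) * (1 / 2 : ℝ) ^ j = tStar - (tStar - t₀) / 2 ^ j
    rw [one_div, inv_pow, div_eq_mul_inv]
  have hlog2 : 0 < Real.log 2 := Real.log_pos (by norm_num)
  have hclose : ∀ j j' : ℕ, FF (s j) = FF (s j') →
      (j : ℝ) ≤ j' + Real.log (K₁ / m₁) / Real.log 2 := by
    intro j j' hjj
    have hl := hlow (s j) (hs_ge j) (hs_lt j)
    have hu := hup (s j') (hs_ge j') (hs_lt j')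
    rw [← hjj] at hu
    set q : ℝ := ν * (1 + ε₀) ^ ((2 : ℝ) * FF (s j)) with hq
    have hsj : tStar - s j = (tStar - t₀) / 2 ^ j := by simp only [hsdef]; ring
    have hsj' : tStar - s j' = (tStar - t₀) / 2 ^ j' := by simp only [hsdef]; ring
    rw [hsj] at hl
    rw [hsj'] at hu
    have h2j : (0 : ℝ) < 2 ^ j := by positivity
    have h2j' : (0 : ℝ) < 2 ^ j' := by positivity
    have hA : m₁ * 2 ^ j ≤ q * (tStar - t₀) := by
      have := mul_le_mul_of_nonneg_right hl h2j.le
      rwa [mul_assoc, div_mul_cancel₀ _ h2j.ne'] at this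
    have hB' : q * (tStar - t₀) < K₁ * 2 ^ j' := by
      have := mul_lt_mul_of_pos_right hu h2j'
      rwa [mul_assoc, div_mul_cancel₀ _ h2j'.ne'] at this
    have hAB : m₁ * 2 ^ j < K₁ * 2 ^ j' := lt_of_le_of_lt hA hB'
    have hlogs := Real.log_lt_log (by positivity) hAB
    rw [Real.log_mul hm₁0.ne' h2j.ne', Real.log_mul hK₁.ne' h2j'.ne', Real.log_pow, Real.log_pow] at hlogs
    rw [Real.log_div hK₁.ne' hm₁0.ne']
    rw [← sub_nonneg]
    have : 0 ≤ ((j' : ℝ) + (Real.log K₁ - Real.log m₁) / Real.log 2 - j) * Real.log 2 := by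
      have h3 : ((j' : ℝ) + (Real.log K₁ - Real.log m₁) / Real.log 2 - j) * Real.log 2
          = j' * Real.log 2 + (Real.log K₁ - Real.log m₁) - j * Real.log 2 := by
        field_simp
      rw [h3]
      linarith
    exact nonneg_of_mul_nonneg_left this hlog2
  have hD : 0 ≤ Real.log (K₁ / m₁) / Real.log 2 := by
    have := hclose 0 0 rfl
    simpa using this
  set D : ℝ := Real.log (K₁ / m₁) / Real.log 2 with hDdef
  refine ⟨t₀ * (C / (tStar - t₀)) + (1 / 2) * ((D + 1) * ∑' n, p n), fun k => ?_⟩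
  set f : ℝ → ℝ := fun t => bigLam ε₀ ^ k * ‖shellVec X k t‖ with hfdef
  have hLk : 0 < bigLam ε₀ ^ k := zpow_pos hΛ k
  have hfcont : ContinuousOn f (Ico 0 tStar) :=
    continuousOn_const.mul (continuousOn_shellVec_of_contDiffOn hV.contDiffOn k).norm
  have hf0 : ∀ t ∈ Ico 0 tStar, 0 ≤ f t := fun t _ => mul_nonneg hLk.le (norm_nonneg _)
  have hGk : ∀ s' : ℝ, t₀ ≤ s' → s' < tStar → ∀ t : ℝ, s' ≤ t → t ≤ s' + (tStar - s') / 2 →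
      f t * (tStar - s') ≤ p (k - FF s') := by
    intro s' hs' hs'T t hst ht2
    have h0s' : 0 ≤ s' := h0t₀.trans hs'
    have h := hhl s' h0s' (h3t₀.trans hs') hs'T (iF s') (FF s') (hFF s' h0s' hs'T) (k - FF s') t hst ht2
    rw [sub_add_cancel] at h
    calc f t * (tStar - s') = bigLam ε₀ ^ k * (tStar - s') * ‖shellVec X k t‖ := by
          simp only [hfdef]; ring
      _ ≤ p (k - FF s') := h
  have htail : ∀ J : ℕ, ∫ t in t₀..s J, f t ≤ (1 / 2) * ((D + 1) * ∑' n, p n) := by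
    intro J
    have h1 := intervalIntegral_le_sum_of_halfLife (G := fun s' => p (k - FF s')) ht₀T
      (hfcont.mono fun x hx => ⟨h0t₀.trans hx.1, hx.2⟩) hGk J
    have h2 := sum_le_of_sparse_fibers hp0 hps hD (F := fun j => FF (s j)) hclose k J
    exact h1.trans (mul_le_mul_of_nonneg_left h2 (by norm_num))
  have hhead : ∫ t in (0 : ℝ)..t₀, f t ≤ t₀ * (C / (tStar - t₀)) := by
    have hint : IntervalIntegrable f volume 0 t₀ :=
      (hfcont.mono fun x hx => ⟨hx.1, lt_of_le_of_lt hx.2 ht₀T⟩).intervalIntegrable_of_Icc h0t₀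
    have hbound : ∀ t ∈ Icc (0 : ℝ) t₀, f t ≤ C / (tStar - t₀) := by
      intro t ht
      have htT : t < tStar := lt_of_le_of_lt ht.2 ht₀T
      have h := htypeI k t ht.1 htT
      rw [le_div_iff₀ hgap]
      calc f t * (tStar - t₀) ≤ f t * (tStar - t) :=
            mul_le_mul_of_nonneg_left (by linarith [ht.2]) (hf0 t ⟨ht.1, htT⟩)
        _ = bigLam ε₀ ^ k * (tStar - t) * ‖shellVec X k t‖ := by simp only [hfdef]; ring
        _ ≤ C := h
    calc ∫ t in (0 : ℝ)..t₀, f t ≤ ∫ _t in (0 : ℝ)..t₀, C / (tStar - t₀) :=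
          intervalIntegral.integral_mono_on h0t₀ hint intervalIntegrable_const hbound
      _ = t₀ * (C / (tStar - t₀)) := by rw [intervalIntegral.integral_const, smul_eq_mul, sub_zero]
  have hpartial : ∀ J : ℕ, ∫ t in (0 : ℝ)..s J, f t ≤
      t₀ * (C / (tStar - t₀)) + (1 / 2) * ((D + 1) * ∑' n, p n) := by
    intro J
    have hint1 : IntervalIntegrable f volume 0 t₀ :=
      (hfcont.mono fun x hx => ⟨hx.1, lt_of_le_of_lt hx.2 ht₀T⟩).intervalIntegrable_of_Icc h0t₀
    have hint2 : IntervalIntegrable f volume t₀ (s J) :=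
      (hfcont.mono fun x hx => ⟨h0t₀.trans hx.1, lt_of_le_of_lt hx.2 (hs_lt J)⟩).intervalIntegrable_of_Icc
        (hs_ge J)
    rw [← intervalIntegral.integral_add_adjacent_intervals hint1 hint2]
    exact add_le_add hhead (htail J)
  obtain ⟨hInt, hle⟩ := integrableOn_Ico_of_intervalIntegral_le hT hfcont hf0 hs0 hs_lt hs_tend hpartial
  have hInt' : IntegrableOn (fun t => ‖shellVec X k t‖) (Ico 0 tStar) := by
    have h : IntegrableOn (fun t => (bigLam ε₀ ^ k)⁻¹ * f t) (Ico 0 tStar) := hInt.const_mul _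
    refine h.congr_fun (fun t _ => ?_) measurableSet_Ico
    show (bigLam ε₀ ^ k)⁻¹ * (bigLam ε₀ ^ k * ‖shellVec X k t‖) = ‖shellVec X k t‖
    rw [inv_mul_cancel_left₀ hLk.ne']
  refine ⟨hInt', ?_⟩
  have heq : bigLam ε₀ ^ k * (∫ t in Ico 0 tStar, ‖shellVec X k t‖) = ∫ t in Ico 0 tStar, f t := by
    simp only [hfdef]
    rw [integral_const_mul]
  rw [heq]
  exact hle

/-- **(ω4) ⟸ (ω3) ∧ (FE) ∧ (WC) ∧ (HL).**  The registered conclusion shape of `stub_eternalLimitViscBdd` —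
`∃ ν̂ W, IsEternalVisc ε₀ ν̂ α W ∧ UniformBound W ∧ EternalSurvivingFwd 1 ε₀ W` (with `ν̂ > 0`, `‖W_0(0)‖ ≥ 1/(32(3+Λ))`) — from
`ViscousUpTo ∧ BlowsUpAt ∧ TypeOne`, the front a=1 envelope (FE), the tree's wake calming (WC) (any profile `P`) and the half-life
co-moving envelope (HL) with a summable profile `p`; the integral hypothesis (UA) of the tree's `eternalLimitViscBdd_of_frontData` is
discharged by `uniformCriticalAction_of_halfLifeWake`.  MODEL lattice only; (FE), (WC), (HL), (ω3) and ⟨20420⟩ remain OPEN.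
[cite: Tao2016AveragedNS, §4 Thm. 4.2 (statement shape), the viscous equation before it, §6.4; KochNadirashviliSereginSverak2009, Thm 1.1 ff.; cell vocabulary (stmt-NavierStokesRegularity-20420)] -/
theorem eternalLimitViscBdd_of_halfLifeWake {R ε₀ ν : ℝ} (hε₀ : 0 < ε₀) (hν : 0 < ν)
    {α : Fin 4 → Fin 4 → Fin 4 → ℤ × ℤ × ℤ → ℝ} (hα : InTableClass R α) {X₀ : Fin 4 → ℝ}
    {X : Fin 4 → ℤ → ℝ → ℝ} {tStar : ℝ} (hV : ViscousUpTo ε₀ ν α X₀ X tStar) (hB : BlowsUpAt ε₀ X tStar)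
    (hT1 : TypeOne ε₀ X tStar)
    (hEnv : ∃ Q t₂ : ℝ, t₂ < tStar ∧ ∀ t : ℝ, 0 ≤ t → t₂ ≤ t → t < tStar → ∀ (i : Fin 4) (F : ℤ),
      1 / (32 * (3 + bigLam ε₀)) ≤ bigLam ε₀ ^ F * |X i F t| * (tStar - t) →
        (1 + ε₀) ^ ((F : ℝ) / 2) * |X i F t| ≤ Q)
    {P : ℤ → ℝ} (hWC : ∃ t₃ : ℝ, t₃ < tStar ∧ ∀ ta : ℝ, 0 ≤ ta → t₃ ≤ ta → ta < tStar → ∀ (i : Fin 4) (F : ℤ),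
      1 / (32 * (3 + bigLam ε₀)) ≤ bigLam ε₀ ^ F * |X i F ta| * (tStar - ta) →
        ∀ (n : ℤ) (t : ℝ), ta ≤ t → t < tStar →
          bigLam ε₀ ^ (n + F) * (tStar - ta) * ‖shellVec X (n + F) t‖ ≤ P n)
    {p : ℤ → ℝ} (hp0 : ∀ n, 0 ≤ p n) (hps : Summable p)
    (hHL : ∃ t₃ : ℝ, t₃ < tStar ∧ ∀ ta : ℝ, 0 ≤ ta → t₃ ≤ ta → ta < tStar → ∀ (i : Fin 4) (F : ℤ),
      1 / (32 * (3 + bigLam ε₀)) ≤ bigLam ε₀ ^ F * |X i F ta| * (tStar - ta) →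
        ∀ (n : ℤ) (t : ℝ), ta ≤ t → t ≤ ta + (tStar - ta) / 2 →
          bigLam ε₀ ^ (n + F) * (tStar - ta) * ‖shellVec X (n + F) t‖ ≤ p n) :
    ∃ νh : ℝ, 0 < νh ∧ ∃ W : ℤ → ℝ → Em 4,
      IsEternalVisc ε₀ νh α W ∧ UniformBound W ∧ EternalSurvivingFwd 1 ε₀ W ∧
        1 / (32 * (3 + bigLam ε₀)) ≤ ‖W 0 0‖ := by
  obtain ⟨A, hUA⟩ := uniformCriticalAction_of_halfLifeWake hε₀ hν hα hV hB hT1 hEnv hp0 hps hHL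
  exact eternalLimitViscBdd_of_frontData hε₀ hν hα hV hB hT1 hEnv hWC hUA

end Summit.NavierStokesRegularity.NavierStokesRegularity.Theorems.EternalRigidityViscBddOne.UniformAction

end
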